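import Mathlib
import Literature.AlgebraicGeometry.Resolution.PolygonShear
import Literature.AlgebraicGeometry.Resolution.FacePreparationPlus
import Literature.AlgebraicGeometry.Resolution.ChartOneVertex
import HarnessLib

/-!
# Translations `y ↦ y − η xⁿ` move Newton points down lines of slope `−1/n` (Cutkosky 2009, Lemma 10.6 / 10.7)

Topic: `Literature/AlgebraicGeometry/Resolution`. S. D. Cutkosky, *Resolution of singularities for
3-folds in positive characteristic*, Amer. J. Math. 131 (2009), §10.3 "Very well preparation"
(author version `paper:doi-10-1353-ajm-0-0036`, p.30 l.28–69): "We will also consider change of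
variables of the form `y₁ = y − ηxⁿ` for `η ∈ k`, `n` a positive integer, which we will call
translations. **Lemma 10.6.** Consider the expansion (19)
`h = Σ_{λ=0}^{j} η^{j−λ} binom(j, λ) x^{i+(j−λ)n} y₁^λ z^k` obtained by substituting `y₁ = y − ηxⁿ`
into the monomial `xⁱ yʲ zᵏ`. Consider the projection for `(a, b, c) ∈ ℕ³` such that `c < r` defined
by `π(a, b, c) = (a/(r−c), b/(r−c))`. Suppose that `k < r`. Set `(a, b) = (i/(r−k), j/(r−k))`. Then
`xⁱ y₁ʲ zᵏ` is the unique monomial in (19) whose coefficients project onto `(a, b)`. All other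
monomials in (19) with non-zero coefficient project to points below `(a, b)` on the line through
`(a, b)` with slope `−1/n`. Lemma 10.6 is proved by a straight forward calculation. We deduce
Lemma 10.7 from Lemma 10.6 and the definition of well preparedness. **Lemma 10.7.** Suppose that
`(I; x, y, z)` is well prepared, `y₁ = y − ηxⁿ` is a translation, and `z₁ = z − ψ(x, y₁)` is a
subsequent well preparation. Then `α_{x,y₁,z₁}(I) = α_{xyz}(I)`, `β_{x,y₁,z₁}(I) = β_{xyz}(I)` and
`γ_{x,y₁,z₁}(I) = γ_{xyz}(I)`." Used in Definition 10.8 (2)(c) (p.31 l.10–14, the translation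
`y₁ = y − ηx^{1/ε}`), Lemma 10.9, Theorem 10.17 (p.34 l.49, p.35 l.38) and p.37 l.73–75.

DICTIONARY (as in `CutkoskySurfaceOmega.lean`): Cutkosky's `(z, x, y)` is the tree's
`c = (c 0, c 1, c 2) = (y, u₁, u₂)`; his `γ`, `δ` are the tree's scaled `deltaS`, `gammaMinusS`
(CJS `δ`, `γ⁻`); the polygon is `pts c J μ` with scaled coordinates `spt₁, spt₂`
(`PolygonInvariants.lean`). **The translation `y₁ = y − ηxⁿ` is the tree's shear
`shiftU₂ c φ = (y, u₁, u₂ + φ u₁)` (`SolvableVertexTransport.lean`) with `φ = −η u₁^{n−1}`**, i.e.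
a shear whose parameter is divisible by `u₁^k`, `k = n − 1`. The tree treats the case `k = 0`
(CJS Lemma 13.6): weighted ideals `F^{W}_ρ` are shear invariant for `W₂ ≤ W₁`, initial forms and
solvability for `W₂ < W₁`, hence `α`, `β`, `δ` and `v`-preparedness are invariant under EVERY
`shiftU₂ c φ` (`PolygonShear.lean`: `alphaS_shiftU₂`, `betaS_shiftU₂`, `deltaS_shiftU₂`,
`vPrepared_shiftU₂_iff`) — in particular under Cutkosky's translations for all `n`, which is the
translation half of Lemma 10.7. PROVED HERE (theorems only, no facts, no definitions), the
expansion-free content of Lemma 10.6 for general `n = k + 1`: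

* `weightedIdealW_shiftU₂_of_pow_dvd` — for `u₁^k ∣ φ`, **`F^{W}_ρ(y, u₁, u₂ + φu₁) = F^{W}_ρ(y, u₁, u₂)`
  whenever `W₂ ≤ (k+1) W₁`**, i.e. for every supporting half-plane `p₁ x₁ + p₂ x₂ ≥ w₀` whose boundary
  has slope `−p₁/p₂ ≤ −1/n` ("all other monomials project to points below `(a, b)` on the line …
  with slope `−1/n`"); `eval_sub_eval_shiftU₂_mem_of_mul_mem` / `_of_pow_dvd` — the substitution
  estimate for `W₂ < (k+1) W₁`; hence `IsInForm.shear_of_pow_dvd`, `isInForm_shiftU₂_iff_of_pow_dvd`,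
  `inForm_shiftU₂_of_pow_dvd`, `isSolvableAt_shiftU₂_iff_of_pow_dvd`, `IsInitialTerm.shear_of_pow_dvd`
  (initial forms, solvability and initial unit terms are unchanged along lines STRICTLY steeper
  than `−1/n`: "`xⁱ y₁ʲ zᵏ` is the unique monomial in (19) whose coefficients project onto `(a, b)`");
* polygon level: `forall_pts_shiftU₂_of_forall_pts_of_pow_dvd` / `forall_pts_shiftU₂_iff_of_pow_dvd`
  (half-planes with `p₂ ≤ (k+1) p₁` containing the polygon are the same before and after),
  `forall_pts_shiftU₂_slopeLine_of_pow_dvd` (the line of slope `−1/n` of Definition 10.8 (2)(c)),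
  `mem_pts_shiftU₂_of_isMinOn_of_pow_dvd` (a vertex cut out by a line with `p₂ < (k+1) p₁` survives);
* OUR COROLLARIES for `n ≥ 2` (`1 ≤ k`), where the `δ`-line `x₁ + x₂` itself is strictly steeper
  than `−1/n`: the lowest point of the polygon on the first line of slope `−1` — Cutkosky's vertex
  `(γ − δ, δ)` — survives (`exists_pts_shiftU₂_wMinus_of_pow_dvd`), **Cutkosky's `δ` (tree `γ⁻`)
  is unchanged** (`gammaMinusS_shiftU₂_of_pow_dvd`), and **preparedness at `w⁻` is unchanged**
  (`wMinusPrepared_shiftU₂_iff_of_pow_dvd`). (For `n = 1` points move along the `δ`-line itself and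
  `δ` can drop — this is why Definition 10.8 (1) and Lemma 10.9 maximise `δ` over the translations
  `y₁ = y − ηx`.)
* OUR COROLLARIES for all shears (`k = 0` suffices; not treated in `PolygonShear.lean`): the upper
  `δ`-vertex `w⁺ = (δ − γ⁺, γ⁺)` survives, `γ⁺` is shear invariant (`gammaPlusS_shiftU₂`) and so is
  preparedness at `w⁺` (`wPlusPrepared_shiftU₂_iff`; the canonical line of `FacePreparationPlus.lean`
  through `w⁺` is strictly steeper than the `δ`-line).

All over a regular local ring `R` of dimension `3` with regular system of parameters `c`, under
`J ⊆ 𝔪^μ` and `pts c J μ ≠ ∅` where levels must be positive. The well-preparation half of Lemma 10.7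
(`z₁ = z − ψ(x, y₁)`) is vertex dissolution (`VertexDissolution.lean`, `FacePreparation.lean`) and is
not repeated here. AI-written formalization; weaker than expert review.

## Sources

* S. D. Cutkosky, Amer. J. Math. 131 (2009) 59–127, §10.3, Lemma 10.6, Lemma 10.7, Def. 10.8,
  p.30 l.28 – p.31 l.14; p.37 l.73–75. [Cutkosky2009]
* V. Cossart, U. Jannsen, S. Saito, LNM 2270 (2020), Lemma 13.6 (the case `n = 1`), Def. 11.1,
  Lemma 12.1 (4), Prop. 14.3 (b). [CossartJannsenSaito2020]
* V. Cossart, O. Piltant, J. Algebra 320 (2008), proof of Lemma 4.5 (2), p. 12. [CossartPiltant2008]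
-/

noncomputable section

open IsLocalRing MvPolynomial

namespace Literature.AlgebraicGeometry.Resolution

universe u

/-! ## Weighted ideals and initial forms under `u₂ ↦ u₂ + φ u₁` with `u₁^k ∣ φ` -/

section Basic

variable {R : Type u} [CommRing R]

/-- Powers of `u₁` have the expected weight: `u₁^m ∈ F^{W}_{m W₁}`. [folklore] -/
private theorem pow_u₁_mem_weightedIdealW (c : Fin 3 → R) (W : Fin 3 → ℕ) (m : ℕ) :
    c 1 ^ m ∈ weightedIdealW c W (m * W 1) :=
  pow_mem_weightedIdealW c W (apply_mem_weightedIdealW c W 1) m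

/-- If `u₁^k ∣ φ` then `φ u₁ ∈ F^{W}_ρ(c′)` for every `ρ ≤ (k+1) W₁` and every system `c′` with the
same `u₁` (e.g. `c′ = c` or `c′` the sheared system). [folklore] -/
private theorem mul_u₁_mem_weightedIdealW_of_pow_dvd (c : Fin 3 → R) {phi : R} {k : ℕ}
    (hphi : c 1 ^ k ∣ phi) (c' : Fin 3 → R) (hc' : c' 1 = c 1) (W : Fin 3 → ℕ) {ρ : ℕ}
    (hρ : ρ ≤ (k + 1) * W 1) : phi * c 1 ∈ weightedIdealW c' W ρ := by
  obtain ⟨q, rfl⟩ := hphi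
  have : c 1 ^ k * q * c 1 = q * c' 1 ^ (k + 1) := by rw [hc', pow_succ]; ring
  rw [this]
  exact Ideal.mul_mem_left _ _
    (weightedIdealW_antitone c' W hρ (pow_u₁_mem_weightedIdealW c' W (k + 1)))

/-- **Lemma 10.6, weighted-ideal form: for `u₁^k ∣ φ` and `W₂ ≤ (k+1) W₁`,
`F^{W}_ρ(y, u₁, u₂ + φ u₁) = F^{W}_ρ(y, u₁, u₂)`** — the translation `y₁ = y − ηx^{k+1}` does not
change any weighted order ideal whose supporting line has slope `≤ −1/(k+1)` ("all other monomials
… project to points below `(a, b)` on the line through `(a, b)` with slope `−1/n`"). The case `k = 0`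
is `weightedIdealW_shiftU₂` (CJS Lemma 13.6). [cite: Cutkosky2009, Lemma 10.6, p.30 l.31–63]
[cite: CossartJannsenSaito2020, Lemma 13.6] -/
theorem weightedIdealW_shiftU₂_of_pow_dvd (c : Fin 3 → R) {phi : R} {k : ℕ}
    (hphi : c 1 ^ k ∣ phi) (W : Fin 3 → ℕ) (hW : W 2 ≤ (k + 1) * W 1) (ρ : ℕ) :
    weightedIdealW (shiftU₂ c phi) W ρ = weightedIdealW c W ρ := by
  apply le_antisymm
  · refine weightedIdealW_le_of_forall_apply_mem c (shiftU₂ c phi) W (fun i => ?_) ρ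
    fin_cases i
    · exact apply_mem_weightedIdealW c W 0
    · exact apply_mem_weightedIdealW c W 1
    · change c 2 + phi * c 1 ∈ weightedIdealW c W (W 2)
      exact Ideal.add_mem _ (apply_mem_weightedIdealW c W 2)
        (mul_u₁_mem_weightedIdealW_of_pow_dvd c hphi c rfl W hW)
  · refine weightedIdealW_le_of_forall_apply_mem (shiftU₂ c phi) c W (fun i => ?_) ρ
    fin_cases i
    · exact apply_mem_weightedIdealW (shiftU₂ c phi) W 0
    · exact apply_mem_weightedIdealW (shiftU₂ c phi) W 1
    · change c 2 ∈ weightedIdealW (shiftU₂ c phi) W (W 2)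
      have h2 : c 2 = shiftU₂ c phi 2 - phi * c 1 := by rw [shiftU₂_two]; ring
      rw [h2]
      exact Ideal.sub_mem _ (apply_mem_weightedIdealW (shiftU₂ c phi) W 2)
        (mul_u₁_mem_weightedIdealW_of_pow_dvd c hphi (shiftU₂ c phi) (shiftU₂_one c phi) W hW)

/-- **Substitution estimate**: if `φ u₁ ∈ F^{w}_{w₂+1}(c)` and `G` is `w`-homogeneous of weight `n`,
then `G(y, u₁, u₂) − G(y, u₁, u₂ + φ u₁) ∈ F^{w}_{n+1}(c)` (expand `(u₂ + t)^{m₂} − u₂^{m₂}`, `t = φ u₁`,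
monomial by monomial; the proof of `eval_sub_eval_shiftU₂_mem` uses only this membership).
[cite: Cutkosky2009, Lemma 10.6, p.30 l.31–63] [cite: CossartJannsenSaito2020, Lemma 13.6] -/
theorem eval_sub_eval_shiftU₂_mem_of_mul_mem (c : Fin 3 → R) {phi : R} {w : Fin 3 → ℕ}
    (htmem : phi * c 1 ∈ weightedIdealW c w (w 2 + 1)) {n : ℕ} {G : MvPolynomial (Fin 3) R}
    (hG : G.IsWeightedHomogeneous w n) :
    eval c G - eval (shiftU₂ c phi) G ∈ weightedIdealW c w (n + 1) := by
  classical
  set t := phi * c 1 with ht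
  have ht'' : t ∈ weightedIdealW c w (w 2) := weightedIdealW_antitone c w (Nat.le_succ _) htmem
  rw [G.as_sum, map_sum, map_sum, ← Finset.sum_sub_distrib]
  refine Ideal.sum_mem _ fun m hm => ?_
  rw [eval_monomial_eq_monom3, eval_monomial_eq_monom3, ← mul_sub]
  refine Ideal.mul_mem_left _ _ ?_
  have hwm : Finsupp.weight w m = n := hG (mem_support_iff.mp hm)
  have hsplit : monom3 c m - monom3 (shiftU₂ c phi) m =
      (c 0 ^ m 0 * c 1 ^ m 1) * (c 2 ^ m 2 - (c 2 + t) ^ m 2) := by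
    simp only [monom3, shiftU₂_zero, shiftU₂_one, shiftU₂_two, ht]; ring
  rw [hsplit]
  have hwt : n = (m 0 * w 0 + m 1 * w 1) + m 2 * w 2 := by
    rw [← hwm, Finsupp.weight_apply, Finsupp.sum_fintype _ _ (by simp)]
    simp only [Fin.sum_univ_three, smul_eq_mul]
  have hpow : c 2 ^ m 2 - (c 2 + t) ^ m 2 ∈ weightedIdealW c w (m 2 * w 2 + 1) := by
    rcases Nat.eq_zero_or_pos (m 2) with h0 | hpos
    · rw [h0, pow_zero, pow_zero, sub_self]; exact Ideal.zero_mem _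
    · obtain ⟨k, hk⟩ : ∃ k, m 2 = k + 1 := ⟨m 2 - 1, by omega⟩
      have key := (Commute.all (c 2) (c 2 + t)).geom_sum₂_mul (m 2)
      rw [← key]
      have hsum : (Finset.range (m 2)).sum (fun i => c 2 ^ i * (c 2 + t) ^ (m 2 - 1 - i)) ∈
          weightedIdealW c w (k * w 2) := by
        refine Ideal.sum_mem _ fun i hi => ?_
        have hi' := Finset.mem_range.mp hi
        have h1 : c 2 ^ i ∈ weightedIdealW c w (i * w 2) :=
          pow_mem_weightedIdealW c w (apply_mem_weightedIdealW c w 2) i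
        have h2 : (c 2 + t) ^ (m 2 - 1 - i) ∈ weightedIdealW c w ((m 2 - 1 - i) * w 2) :=
          pow_mem_weightedIdealW c w (Ideal.add_mem _ (apply_mem_weightedIdealW c w 2) ht'') _
        have := weightedIdealW_mul_le c w _ _ (Ideal.mul_mem_mul h1 h2)
        refine weightedIdealW_antitone c w ?_ this
        have : i + (m 2 - 1 - i) = k := by omega
        rw [← add_mul, this]
      have hdiff : c 2 - (c 2 + t) = -t := by ring
      rw [hdiff]
      have := weightedIdealW_mul_le c w _ _ (Ideal.mul_mem_mul hsum
        ((weightedIdealW c w _).neg_mem htmem))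
      refine weightedIdealW_antitone c w ?_ this
      rw [hk]; ring_nf; omega
  have hu : c 0 ^ m 0 * c 1 ^ m 1 ∈ weightedIdealW c w (m 0 * w 0 + m 1 * w 1) :=
    weightedIdealW_mul_le c w _ _ (Ideal.mul_mem_mul
      (pow_mem_weightedIdealW c w (apply_mem_weightedIdealW c w 0) _)
      (pow_mem_weightedIdealW c w (apply_mem_weightedIdealW c w 1) _))
  have := weightedIdealW_mul_le c w _ _ (Ideal.mul_mem_mul hu hpow)
  refine weightedIdealW_antitone c w ?_ this
  rw [hwt]; omega

/-- **Substitution estimate for `y₁ = y − ηx^{k+1}`**: for `u₁^k ∣ φ`, `W₂ < (k+1) W₁` and `G`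
`W`-homogeneous of weight `n`, `G(y, u₁, u₂) − G(y, u₁, u₂ + φ u₁) ∈ F^{W}_{n+1}` — along a line strictly
steeper than `−1/(k+1)` the other monomials of (19) have larger weight.
[cite: Cutkosky2009, Lemma 10.6, p.30 l.31–63] -/
theorem eval_sub_eval_shiftU₂_mem_of_pow_dvd (c : Fin 3 → R) {phi : R} {k : ℕ}
    (hphi : c 1 ^ k ∣ phi) {w : Fin 3 → ℕ} (hw : w 2 < (k + 1) * w 1) {n : ℕ}
    {G : MvPolynomial (Fin 3) R} (hG : G.IsWeightedHomogeneous w n) :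
    eval c G - eval (shiftU₂ c phi) G ∈ weightedIdealW c w (n + 1) :=
  eval_sub_eval_shiftU₂_mem_of_mul_mem c (mul_u₁_mem_weightedIdealW_of_pow_dvd c hphi c rfl w hw) hG

/-- **Initial forms survive the translation** (one direction): for `u₁^k ∣ φ` and `W₂ < (k+1) W₁`, a
`W`-initial form witness for `c` is one for the sheared system.
[cite: Cutkosky2009, Lemma 10.6, p.30 l.59–63] -/
theorem IsInForm.shear_of_pow_dvd [IsLocalRing R] {c : Fin 3 → R} {phi : R} {k : ℕ}
    (hphi : c 1 ^ k ∣ phi) {w : Fin 3 → ℕ} (hw : w 2 < (k + 1) * w 1) {n : ℕ} {f : R}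
    {P : MvPolynomial (Fin 3) (ResidueField R)} (h : IsInForm c w n f P) :
    IsInForm (shiftU₂ c phi) w n f P := by
  obtain ⟨G, hG, hGP, hGrem⟩ := h
  refine ⟨G, hG, hGP, ?_⟩
  rw [weightedIdealW_shiftU₂_of_pow_dvd c hphi w hw.le]
  have : f - eval (shiftU₂ c phi) G = (f - eval c G) + (eval c G - eval (shiftU₂ c phi) G) := by
    ring
  rw [this]
  exact Ideal.add_mem _ hGrem (eval_sub_eval_shiftU₂_mem_of_pow_dvd c hphi hw hG)

/-- The inverse translation has a parameter divisible by the same power of `u₁`. [folklore] -/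
private theorem pow_dvd_neg_shiftU₂ (c : Fin 3 → R) {phi : R} {k : ℕ} (hphi : c 1 ^ k ∣ phi) :
    shiftU₂ c phi 1 ^ k ∣ -phi := by
  rw [shiftU₂_one]; exact (dvd_neg).mpr hphi

/-- **Initial forms are translation invariant** for `u₁^k ∣ φ` and `W₂ < (k+1) W₁`.
[cite: Cutkosky2009, Lemma 10.6, p.30 l.59–63] -/
theorem isInForm_shiftU₂_iff_of_pow_dvd [IsLocalRing R] (c : Fin 3 → R) {phi : R} {k : ℕ}
    (hphi : c 1 ^ k ∣ phi) {w : Fin 3 → ℕ} (hw : w 2 < (k + 1) * w 1) (n : ℕ) (f : R)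
    (P : MvPolynomial (Fin 3) (ResidueField R)) :
    IsInForm (shiftU₂ c phi) w n f P ↔ IsInForm c w n f P := by
  refine ⟨fun h => ?_, IsInForm.shear_of_pow_dvd hphi hw⟩
  have := h.shear_of_pow_dvd (pow_dvd_neg_shiftU₂ c hphi) hw
  rwa [shiftU₂_shiftU₂_neg] at this

/-- **Initial unit terms survive the translation**: for `u₁^k ∣ φ` and `W₂ < (k+1) W₁`, a `W`-initial
unit term of `f` for `c` is one for the sheared system ("`xⁱ y₁ʲ zᵏ` is the unique monomial in (19)
whose coefficients project onto `(a, b)`"). [cite: Cutkosky2009, Lemma 10.6, p.30 l.59–63] -/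
theorem IsInitialTerm.shear_of_pow_dvd {c : Fin 3 → R} {phi : R} {k : ℕ} (hphi : c 1 ^ k ∣ phi)
    {w : Fin 3 → ℕ} (hw : w 2 < (k + 1) * w 1) {f : R} {e : Fin 3 →₀ ℕ}
    (h : IsInitialTerm c w f e) : IsInitialTerm (shiftU₂ c phi) w f e := by
  obtain ⟨F, hF, hFu, hrem⟩ := h
  refine ⟨F, hF, hFu, ?_⟩
  rw [weightedIdealW_shiftU₂_of_pow_dvd c hphi w hw.le]
  have : f - eval (shiftU₂ c phi) F = (f - eval c F) + (eval c F - eval (shiftU₂ c phi) F) := by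
    ring
  rw [this]
  exact Ideal.add_mem _ hrem (eval_sub_eval_shiftU₂_mem_of_pow_dvd c hphi hw hF)

variable [IsRegularLocalRing R] (c : Fin 3 → R)
  (hgen : Ideal.span {c 0, c 1, c 2} = maximalIdeal R) (hdim : ringKrullDim R = 3)

include hgen hdim in
/-- `inForm` is translation invariant for `u₁^k ∣ φ`, `W₂ < (k+1) W₁` (positive weights, `f ∈ F_n`).
[cite: Cutkosky2009, Lemma 10.6, p.30 l.59–63] -/
theorem inForm_shiftU₂_of_pow_dvd {phi : R} {k : ℕ} (hphi : c 1 ^ k ∣ phi) {w : Fin 3 → ℕ}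
    (hwpos : ∀ i, 0 < w i) (hw : w 2 < (k + 1) * w 1) {n : ℕ} {f : R}
    (hf : f ∈ weightedIdealW c w n) :
    inForm (shiftU₂ c phi) w n f = inForm c w n f := by
  have hgen' : Ideal.span {shiftU₂ c phi 0, shiftU₂ c phi 1, shiftU₂ c phi 2} = maximalIdeal R := by
    rw [span_triple_shiftU₂]; exact hgen
  have h := (isInForm_inForm c hgen hdim hwpos hf).shear_of_pow_dvd hphi hw
  exact (h.eq_inForm (shiftU₂ c phi) hgen' hdim hwpos).symm

include hgen hdim in
/-- **Solvability of a vertex is translation invariant** for `u₁^k ∣ φ` along any positive weight with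
`W₂ < (k+1) W₁`: the initial forms of `J` along a line strictly steeper than `−1/(k+1)` are the same
for `(y, u₁, u₂)` and `(y, u₁, u₂ + φu₁)`, so "(not) prepared" in the sense of Cutkosky p.29 l.5–12
(Cossart–Piltant solvability) is unchanged at every vertex such a line cuts out. The case `k = 0` is
`isSolvableAt_shiftU₂_iff`. [cite: Cutkosky2009, Lemma 10.6 and Lemma 10.7, p.30 l.59–69] -/
theorem isSolvableAt_shiftU₂_iff_of_pow_dvd {phi : R} {k : ℕ} (hphi : c 1 ^ k ∣ phi) {J : Ideal R}
    {w : Fin 3 → ℕ} (hwpos : ∀ i, 0 < w i) (hw : w 2 < (k + 1) * w 1) {n μ : ℕ}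
    {v : Fin 3 →₀ ℕ} {lam : ResidueField R} :
    IsSolvableAt (shiftU₂ c phi) J w n μ v lam ↔ IsSolvableAt c J w n μ v lam := by
  unfold IsSolvableAt
  refine and_congr_right fun _ => and_congr_right fun _ => ?_
  refine forall_congr' fun f => forall_congr' fun hfJ => ?_
  rw [weightedIdealW_shiftU₂_of_pow_dvd c hphi w hw.le]
  refine forall_congr' fun hfn => ?_
  rw [inForm_shiftU₂_of_pow_dvd c hgen hdim hphi hwpos hw hfn]

end Basic

/-! ## The level of the canonical line through `w⁺` -/

section Lines

variable {R : Type u} [CommRing R] {c : Fin 3 → R} {J : Ideal R} {μ : ℕ}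

/-- The level of the canonical line through `w⁺` is attained at `w⁺`:
`(N+1) e₁ + N e₂ = (N+1) δs − γ⁺s` for `e₁ + e₂ = δs`, `e₂ = γ⁺s`, `N = δs + 1`. [folklore] -/
private theorem wPlusLevel_eq_of_wPlus {e : Fin 3 →₀ ℕ} (h1 : spt₁ μ e + spt₂ μ e = deltaS c J μ)
    (h2 : spt₂ μ e = gammaPlusS c J μ) :
    (tiltPN c J μ + 1) * spt₁ μ e + tiltPN c J μ * spt₂ μ e = wPlusLevel c J μ := by
  rw [wPlusLevel, ← h1, ← h2]
  have : (tiltPN c J μ + 1) * (spt₁ μ e + spt₂ μ e) =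
      (tiltPN c J μ + 1) * spt₁ μ e + tiltPN c J μ * spt₂ μ e + spt₂ μ e := by ring
  rw [this, Nat.add_sub_cancel]

end Lines

/-! ## The polygon under translations -/

section Polygon

variable {R : Type u} [CommRing R] [IsRegularLocalRing R] (c : Fin 3 → R)
  (hgen : Ideal.span {c 0, c 1, c 2} = maximalIdeal R) (hdim : ringKrullDim R = 3)
  {phi : R} {k : ℕ} (hphi : c 1 ^ k ∣ phi) {J : Ideal R} {μ : ℕ}

omit [IsRegularLocalRing R] in
/-- The sheared system generates the maximal ideal (bookkeeping). [folklore] -/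
private theorem span_shiftU₂_eq_maximalIdeal [IsLocalRing R]
    (hgen : Ideal.span {c 0, c 1, c 2} = maximalIdeal R) (phi : R) :
    Ideal.span {shiftU₂ c phi 0, shiftU₂ c phi 1, shiftU₂ c phi 2} = maximalIdeal R := by
  rw [span_triple_shiftU₂]; exact hgen

include hgen hdim in
/-- `δs ≥ L = μ!` when `J ⊆ 𝔪^μ` and the polygon is non-empty (CJS Lemma 8.4 (1): `δ ≥ 1`).
[cite: CossartJannsenSaito2020, Lemma 8.4 (1)] -/
theorem factorial_le_deltaS (hJμ : J ≤ maximalIdeal R ^ μ) (hne : (pts c J μ).Nonempty) :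
    μ.factorial ≤ deltaS c J μ := by
  obtain ⟨e, he, h⟩ := exists_pts_deltaS hne
  rw [← h]; exact factorial_le_spt_add c hgen hdim hJμ he

include hgen hdim hphi in
/-- **Lemma 10.6 at the level of the polygon: half-planes of slope `≤ −1/(k+1)` transfer** — if
`p₁ x₁ + p₂ x₂ ≥ w₀` (`p₁, p₂, w₀ > 0`, `p₂ ≤ (k+1) p₁`) holds on `pts c J μ`, it holds on
`pts (y, u₁, u₂ + φu₁) J μ` for `u₁^k ∣ φ` (the new Newton points lie below-right of old ones on lines
of slope `−1/(k+1)`, which stay in every such half-plane). The case `k = 0` (`p₂ ≤ p₁`) is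
`forall_pts_shiftU₂_of_forall_pts`. [cite: Cutkosky2009, Lemma 10.6, p.30 l.59–63] -/
theorem forall_pts_shiftU₂_of_forall_pts_of_pow_dvd {w₀ p₁ p₂ : ℕ} (hw₀ : 0 < w₀) (hp₁ : 0 < p₁)
    (hp₂ : 0 < p₂) (hp : p₂ ≤ (k + 1) * p₁)
    (hS : ∀ e ∈ pts c J μ, w₀ ≤ p₁ * spt₁ μ e + p₂ * spt₂ μ e) :
    ∀ e ∈ pts (shiftU₂ c phi) J μ, w₀ ≤ p₁ * spt₁ μ e + p₂ * spt₂ μ e := by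
  have h1 := (le_weightedIdealW_levelWeight_iff c hgen hdim J hw₀ hp₁ hp₂).mpr hS
  have hW : levelWeight μ w₀ p₁ p₂ 2 ≤ (k + 1) * levelWeight μ w₀ p₁ p₂ 1 := by
    rw [levelWeight_one, levelWeight_two]
    calc μ.factorial * p₂ ≤ μ.factorial * ((k + 1) * p₁) := Nat.mul_le_mul_left _ hp
      _ = (k + 1) * (μ.factorial * p₁) := by ring
  rw [← weightedIdealW_shiftU₂_of_pow_dvd c hphi (levelWeight μ w₀ p₁ p₂) hW] at h1
  exact (le_weightedIdealW_levelWeight_iff (shiftU₂ c phi)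
    (span_shiftU₂_eq_maximalIdeal c hgen phi) hdim J hw₀ hp₁ hp₂).mp h1

include hgen hdim hphi in
/-- **The half-planes of slope `≤ −1/(k+1)` containing the polygon are the same before and after the
translation** (shear back by `−φ`). [cite: Cutkosky2009, Lemma 10.6, p.30 l.59–63] -/
theorem forall_pts_shiftU₂_iff_of_pow_dvd {w₀ p₁ p₂ : ℕ} (hw₀ : 0 < w₀) (hp₁ : 0 < p₁)
    (hp₂ : 0 < p₂) (hp : p₂ ≤ (k + 1) * p₁) :
    (∀ e ∈ pts (shiftU₂ c phi) J μ, w₀ ≤ p₁ * spt₁ μ e + p₂ * spt₂ μ e) ↔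
      ∀ e ∈ pts c J μ, w₀ ≤ p₁ * spt₁ μ e + p₂ * spt₂ μ e := by
  refine ⟨fun h => ?_, forall_pts_shiftU₂_of_forall_pts_of_pow_dvd c hgen hdim hphi hw₀ hp₁ hp₂ hp⟩
  have := forall_pts_shiftU₂_of_forall_pts_of_pow_dvd (shiftU₂ c phi)
    (span_shiftU₂_eq_maximalIdeal c hgen phi) hdim (pow_dvd_neg_shiftU₂ c hphi) hw₀ hp₁ hp₂ hp h
  rwa [shiftU₂_shiftU₂_neg] at this

include hgen hdim hphi in
/-- **The line of slope `−1/n` through a point is respected** (Definition 10.8 (2)(c), `n = 1/ε`): if the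
polygon of `c` lies in the half-plane `x₁ + (k+1) x₂ ≥ w₀` (e.g. `w₀ = αs + (k+1) βs`: no point below the
line of slope `−1/(k+1)` through `v`), then so does the polygon of the translated system — weight
`(w₀, L, L(k+1))`, the boundary case `W₂ = (k+1) W₁`. [cite: Cutkosky2009, Lemma 10.6 and Definition 10.8 (2)(c), p.30 l.59–63, p.31 l.10–14] -/
theorem forall_pts_shiftU₂_slopeLine_of_pow_dvd {w₀ : ℕ} (hw₀ : 0 < w₀)
    (hS : ∀ e ∈ pts c J μ, w₀ ≤ 1 * spt₁ μ e + (k + 1) * spt₂ μ e) :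
    ∀ e ∈ pts (shiftU₂ c phi) J μ, w₀ ≤ 1 * spt₁ μ e + (k + 1) * spt₂ μ e :=
  forall_pts_shiftU₂_of_forall_pts_of_pow_dvd c hgen hdim hphi hw₀ Nat.one_pos (Nat.succ_pos k)
    (by rw [mul_one]) hS

include hgen hdim hphi in
/-- **Vertices cut out by lines strictly steeper than `−1/(k+1)` survive the translation**: if
`e⋆ ∈ pts c J μ` minimises the positive form `p₁ x₁ + p₂ x₂` with `p₂ < (k+1) p₁` and positive value,
then `e⋆ ∈ pts (y, u₁, u₂ + φu₁) J μ` for `u₁^k ∣ φ` ("`xⁱ y₁ʲ zᵏ` is the unique monomial in (19) whose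
coefficients project onto `(a, b)`": the point keeps its initial unit term).
[cite: Cutkosky2009, Lemma 10.6, p.30 l.59–63] -/
theorem mem_pts_shiftU₂_of_isMinOn_of_pow_dvd {p₁ p₂ : ℕ} (hp₁ : 0 < p₁) (hp₂ : 0 < p₂)
    (hp : p₂ < (k + 1) * p₁) {e : Fin 3 →₀ ℕ} (he : e ∈ pts c J μ)
    (hmin : ∀ x ∈ pts c J μ, p₁ * spt₁ μ e + p₂ * spt₂ μ e ≤ p₁ * spt₁ μ x + p₂ * spt₂ μ x)
    (hpos : 0 < p₁ * spt₁ μ e + p₂ * spt₂ μ e) :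
    e ∈ pts (shiftU₂ c phi) J μ := by
  obtain ⟨g, hgJ, hinit⟩ :=
    exists_isInitialTerm_levelWeight_of_isMinOn c hgen hdim hp₁ hp₂ he hmin hpos
  have hW : levelWeight μ (p₁ * spt₁ μ e + p₂ * spt₂ μ e) p₁ p₂ 2 <
      (k + 1) * levelWeight μ (p₁ * spt₁ μ e + p₂ * spt₂ μ e) p₁ p₂ 1 := by
    rw [levelWeight_one, levelWeight_two]
    calc μ.factorial * p₂ < μ.factorial * ((k + 1) * p₁) :=
        Nat.mul_lt_mul_of_pos_left hp (Nat.factorial_pos μ)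
      _ = (k + 1) * (μ.factorial * p₁) := by ring
  exact ⟨⟨g, hgJ, _, levelWeight_pos hpos hp₁ hp₂, hinit.shear_of_pow_dvd hphi hW⟩, he.2⟩

/-! ### `n ≥ 2`: the vertex `w⁻ = (δ − γ⁻, γ⁻)` (Cutkosky's `(γ − δ, δ)`) and its preparedness -/

include hgen hdim hphi in
/-- **For `n = k + 1 ≥ 2` the lowest point of the polygon on the first line of slope `−1` survives the
translation `y₁ = y − ηxⁿ`**: some Newton point of `(y, u₁, u₂ + φu₁)`, `u₁^k ∣ φ`, `k ≥ 1`, sits at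
`(δs − γ⁻s, γ⁻s)` of `c` — `w⁻` is cut out by the tilted line `M x₁ + (M+1) x₂` with `M = 2(γ⁻s + 1)`,
which is strictly steeper than `−1/2`. OUR COROLLARY of Lemma 10.6 (for `n = 1` this fails: points
move along the `δ`-line). [cite: Cutkosky2009, Lemma 10.6, p.30 l.59–63] -/
theorem exists_pts_shiftU₂_wMinus_of_pow_dvd (hk : 1 ≤ k) (hJμ : J ≤ maximalIdeal R ^ μ)
    (hne : (pts c J μ).Nonempty) :
    ∃ e ∈ pts (shiftU₂ c phi) J μ,
      spt₁ μ e + spt₂ μ e = deltaS c J μ ∧ spt₂ μ e = gammaMinusS c J μ := by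
  obtain ⟨e, he, h1, h2⟩ := exists_pts_wMinus hne
  have hL : μ.factorial ≤ spt₁ μ e + spt₂ μ e := factorial_le_spt_add c hgen hdim hJμ he
  have hLpos := Nat.factorial_pos μ
  have he' : 2 * (gammaMinusS c J μ + 1) * spt₁ μ e + (2 * (gammaMinusS c J μ + 1) + 1) * spt₂ μ e =
      2 * (gammaMinusS c J μ + 1) * deltaS c J μ + gammaMinusS c J μ := by
    rw [← h1, ← h2]; ring
  have hmin : ∀ x ∈ pts c J μ,
      2 * (gammaMinusS c J μ + 1) * spt₁ μ e + (2 * (gammaMinusS c J μ + 1) + 1) * spt₂ μ e ≤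
        2 * (gammaMinusS c J μ + 1) * spt₁ μ x + (2 * (gammaMinusS c J μ + 1) + 1) * spt₂ μ x := by
    intro x hx
    rw [he']
    exact forall_pts_tilt (by omega) x hx
  have hpos : 0 < 2 * (gammaMinusS c J μ + 1) * spt₁ μ e +
      (2 * (gammaMinusS c J μ + 1) + 1) * spt₂ μ e := by
    have h3 : spt₁ μ e ≤ 2 * (gammaMinusS c J μ + 1) * spt₁ μ e :=
      Nat.le_mul_of_pos_left _ (by omega)
    have h4 : spt₂ μ e ≤ (2 * (gammaMinusS c J μ + 1) + 1) * spt₂ μ e :=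
      Nat.le_mul_of_pos_left _ (by omega)
    omega
  have hp : 2 * (gammaMinusS c J μ + 1) + 1 < (k + 1) * (2 * (gammaMinusS c J μ + 1)) := by
    have : 2 * (2 * (gammaMinusS c J μ + 1)) ≤ (k + 1) * (2 * (gammaMinusS c J μ + 1)) :=
      Nat.mul_le_mul_right _ (by omega)
    omega
  exact ⟨e, mem_pts_shiftU₂_of_isMinOn_of_pow_dvd c hgen hdim hphi (by omega) (by omega) hp he
    hmin hpos, h1, h2⟩

include hgen hdim hphi in
/-- **For `n ≥ 2`, Cutkosky's `δ` (the tree's `γ⁻`: ordinate of the lowest point on the first line of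
slope `−1`) is unchanged by the translation `y₁ = y − ηxⁿ`** (`u₁^k ∣ φ`, `k ≥ 1`, `J ⊆ 𝔪^μ`,
non-empty polygon): `w⁻` survives and the tilted half-plane `M x₁ + (M+1) x₂ ≥ M δs + γ⁻s`,
`M = γ⁻s + 1`, whose boundary has slope `−M/(M+1) ≤ −1/2 ≤ −1/n`, transfers. OUR COROLLARY of
Lemma 10.6; compare Definition 10.8 (1), where `n = 1` and `δ` may drop. [cite: Cutkosky2009, Lemma 10.6 and Lemma 10.7, p.30 l.59–69] -/
theorem gammaMinusS_shiftU₂_of_pow_dvd (hk : 1 ≤ k) (hJμ : J ≤ maximalIdeal R ^ μ)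
    (hne : (pts c J μ).Nonempty) :
    gammaMinusS (shiftU₂ c phi) J μ = gammaMinusS c J μ := by
  have hδ : deltaS (shiftU₂ c phi) J μ = deltaS c J μ := deltaS_shiftU₂ c hgen hdim phi hJμ hne
  have hne' := pts_shiftU₂_nonempty c hgen hdim phi hJμ hne
  obtain ⟨e, he', h1, h2⟩ := exists_pts_shiftU₂_wMinus_of_pow_dvd c hgen hdim hphi hk hJμ hne
  apply le_antisymm
  · rw [← h2]; exact gammaMinusS_le he' (by rw [hδ]; exact h1)
  · obtain ⟨e', he'', h1', h2'⟩ := exists_pts_wMinus hne'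
    have hδpos : 0 < deltaS c J μ := by
      have := factorial_le_deltaS c hgen hdim hJμ hne
      have := Nat.factorial_pos μ
      omega
    have hw₀ : 0 < (gammaMinusS c J μ + 1) * deltaS c J μ + gammaMinusS c J μ := by
      have : deltaS c J μ ≤ (gammaMinusS c J μ + 1) * deltaS c J μ :=
        Nat.le_mul_of_pos_left _ (by omega)
      omega
    have hp : gammaMinusS c J μ + 1 + 1 ≤ (k + 1) * (gammaMinusS c J μ + 1) := by
      have : 2 * (gammaMinusS c J μ + 1) ≤ (k + 1) * (gammaMinusS c J μ + 1) :=
        Nat.mul_le_mul_right _ (by omega)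
      omega
    have ht := forall_pts_shiftU₂_of_forall_pts_of_pow_dvd c hgen hdim hphi hw₀ (by omega)
      (by omega) hp (forall_pts_tilt (Nat.le_succ _)) e' he''
    have hsplit : (gammaMinusS c J μ + 1) * spt₁ μ e' + (gammaMinusS c J μ + 1 + 1) * spt₂ μ e' =
        (gammaMinusS c J μ + 1) * (spt₁ μ e' + spt₂ μ e') + spt₂ μ e' := by ring
    rw [hsplit, h1', hδ] at ht
    rw [← h2']
    omega

omit [IsRegularLocalRing R] in
/-- Solvability of `w⁻` along the canonical tilted line `(γ⁻s+1) x₁ + (γ⁻s+2) x₂` equals solvability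
along the twice-tilted line `2(γ⁻s+1) x₁ + (2(γ⁻s+1)+1) x₂` (both meet the polygon only at `w⁻`;
private plumbing over `isSolvableAt_iff_of_same_vertex`, with the invariants `δs = D`, `γ⁻s = G`
passed as numbers so that two systems with the same invariants get literally the same line). [folklore] -/
private theorem isSolvableAt_wMinus_iff_tilted2 [IsRegularLocalRing R] (hdim : ringKrullDim R = 3)
    (c₁ : Fin 3 → R) (hgen₁ : Ideal.span {c₁ 0, c₁ 1, c₁ 2} = maximalIdeal R)
    (hJμ : J ≤ maximalIdeal R ^ μ) (hne₁ : (pts c₁ J μ).Nonempty) {D G : ℕ}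
    (hD : deltaS c₁ J μ = D) (hG : gammaMinusS c₁ J μ = G) {v₁ v₂ : ℕ}
    (hv₁ : D = μ.factorial * v₁ + G) (hv₂ : G = μ.factorial * v₂) (lam : ResidueField R) :
    IsSolvableAt c₁ J (wMinusWeight c₁ J μ) (wMinusLevel c₁ J μ * μ) μ (vexp v₁ v₂) lam ↔
      IsSolvableAt c₁ J (levelWeight μ (2 * (G + 1) * D + G) (2 * (G + 1)) (2 * (G + 1) + 1))
        ((2 * (G + 1) * D + G) * μ) μ (vexp v₁ v₂) lam := by
  have hL := Nat.factorial_pos μ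
  have hDpos : 0 < D := by
    have := factorial_le_deltaS c₁ hgen₁ hdim hJμ hne₁
    omega
  have hw₀ : 0 < wMinusLevel c₁ J μ := by
    rw [wMinusLevel, tiltN, hD, hG]
    have : D ≤ (G + 1) * D := Nat.le_mul_of_pos_left _ (by omega)
    omega
  have hq₀ : 0 < 2 * (G + 1) * D + G := by
    have : D ≤ 2 * (G + 1) * D := Nat.le_mul_of_pos_left _ (by omega)
    omega
  refine isSolvableAt_iff_of_same_vertex c₁ hgen₁ hdim hw₀ (by rw [tiltN]; omega)
    (by rw [tiltN]; omega) hq₀ (by omega) (by omega) ?_ ?_ ?_ ?_ ?_ ?_ lam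
  · rw [wMinusLevel, tiltN, hD, hG, hv₁, hv₂]; ring
  · rw [hv₁, hv₂]; ring
  · intro e he
    have := forall_pts_wMinusWeight e he
    rwa [tiltN] at this ⊢
  · intro e he
    have := forall_pts_tilt (c := c₁) (J := J) (μ := μ) (N := 2 * (G + 1)) (by rw [hG]; omega) e he
    rwa [hD, hG] at this
  · intro e he h
    rw [tiltN] at h
    have := eq_wMinus_of_wMinusLine he (by rw [tiltN]; exact h)
    omega
  · intro e he h
    rw [← hD, ← hG] at h
    have := eq_wMinus_of_tilt (by rw [hG]; omega) he h
    omega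

include hgen hdim hphi in
/-- **For `n ≥ 2`, preparedness at `w⁻` is unchanged by the translation `y₁ = y − ηxⁿ`** (`u₁^k ∣ φ`,
`k ≥ 1`, `J ⊆ 𝔪^μ`, non-empty polygon): the two systems have the same `δs`, `γ⁻s`, hence the same
canonical tilted line through `w⁻`; solvability of `w⁻` is read on the twice-tilted line
`2(γ⁻s+1) x₁ + (2γ⁻s+3) x₂`, which is strictly steeper than `−1/2`, where it is translation invariant
(`isSolvableAt_shiftU₂_iff_of_pow_dvd`). OUR COROLLARY of Lemma 10.6 ("(not) prepared" of Cutkosky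
p.29 l.5–12 at the vertex `(γ − δ, δ)`); for `n = 1` it fails.
[cite: Cutkosky2009, Lemma 10.6 and Lemma 10.7, p.30 l.59–69] [cite: CossartJannsenSaito2020, Lemma 12.1 (4)] -/
theorem wMinusPrepared_shiftU₂_iff_of_pow_dvd (hk : 1 ≤ k) (hJμ : J ≤ maximalIdeal R ^ μ)
    (hne : (pts c J μ).Nonempty) :
    WMinusPrepared (shiftU₂ c phi) J μ ↔ WMinusPrepared c J μ := by
  have hgen' := span_shiftU₂_eq_maximalIdeal c hgen phi
  have hne' := pts_shiftU₂_nonempty c hgen hdim phi hJμ hne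
  have hδ : deltaS (shiftU₂ c phi) J μ = deltaS c J μ := deltaS_shiftU₂ c hgen hdim phi hJμ hne
  have hγ : gammaMinusS (shiftU₂ c phi) J μ = gammaMinusS c J μ :=
    gammaMinusS_shiftU₂_of_pow_dvd c hgen hdim hphi hk hJμ hne
  have hL := Nat.factorial_pos μ
  have hDpos : 0 < deltaS c J μ := by
    have := factorial_le_deltaS c hgen hdim hJμ hne
    omega
  have hq₀ : 0 < 2 * (gammaMinusS c J μ + 1) * deltaS c J μ + gammaMinusS c J μ := by
    have : deltaS c J μ ≤ 2 * (gammaMinusS c J μ + 1) * deltaS c J μ :=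
      Nat.le_mul_of_pos_left _ (by omega)
    omega
  have hWpos : ∀ i, 0 < levelWeight μ (2 * (gammaMinusS c J μ + 1) * deltaS c J μ + gammaMinusS c J μ)
      (2 * (gammaMinusS c J μ + 1)) (2 * (gammaMinusS c J μ + 1) + 1) i :=
    levelWeight_pos hq₀ (by omega) (by omega)
  have hWlt : levelWeight μ (2 * (gammaMinusS c J μ + 1) * deltaS c J μ + gammaMinusS c J μ)
      (2 * (gammaMinusS c J μ + 1)) (2 * (gammaMinusS c J μ + 1) + 1) 2 <
      (k + 1) * levelWeight μ (2 * (gammaMinusS c J μ + 1) * deltaS c J μ + gammaMinusS c J μ)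
        (2 * (gammaMinusS c J μ + 1)) (2 * (gammaMinusS c J μ + 1) + 1) 1 := by
    rw [levelWeight_one, levelWeight_two]
    have h2 : 2 * (gammaMinusS c J μ + 1) + 1 < (k + 1) * (2 * (gammaMinusS c J μ + 1)) := by
      have : 2 * (2 * (gammaMinusS c J μ + 1)) ≤ (k + 1) * (2 * (gammaMinusS c J μ + 1)) :=
        Nat.mul_le_mul_right _ (by omega)
      omega
    calc μ.factorial * (2 * (gammaMinusS c J μ + 1) + 1)
        < μ.factorial * ((k + 1) * (2 * (gammaMinusS c J μ + 1))) :=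
          Nat.mul_lt_mul_of_pos_left h2 hL
      _ = (k + 1) * (μ.factorial * (2 * (gammaMinusS c J μ + 1))) := by ring
  constructor
  · intro h v₁ v₂ lam hv₁ hv₂ hsol
    have key := (isSolvableAt_wMinus_iff_tilted2 hdim c hgen hJμ hne rfl rfl hv₁ hv₂ lam).mp hsol
    rw [← isSolvableAt_shiftU₂_iff_of_pow_dvd c hgen hdim hphi hWpos hWlt] at key
    exact h v₁ v₂ lam (by rw [hδ, hγ]; exact hv₁) (by rw [hγ]; exact hv₂)
      ((isSolvableAt_wMinus_iff_tilted2 hdim (shiftU₂ c phi) hgen' hJμ hne' hδ hγ hv₁ hv₂ lam).mpr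
        key)
  · intro h v₁ v₂ lam hv₁ hv₂ hsol
    rw [hδ, hγ] at hv₁
    rw [hγ] at hv₂
    have key := (isSolvableAt_wMinus_iff_tilted2 hdim (shiftU₂ c phi) hgen' hJμ hne' hδ hγ hv₁ hv₂
      lam).mp hsol
    rw [isSolvableAt_shiftU₂_iff_of_pow_dvd c hgen hdim hphi hWpos hWlt] at key
    exact h v₁ v₂ lam hv₁ hv₂
      ((isSolvableAt_wMinus_iff_tilted2 hdim c hgen hJμ hne rfl rfl hv₁ hv₂ lam).mpr key)

/-! ### All shears: the vertex `w⁺ = (δ − γ⁺, γ⁺)` and its preparedness -/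

include hgen hdim in
/-- **The upper `δ`-vertex `w⁺` survives every shear `u₂ ↦ u₂ + φu₁`** (`J ⊆ 𝔪^μ`, non-empty polygon):
`w⁺` is cut out by the canonical line `(N+1) x₁ + N x₂`, `N = δs + 1`, of `FacePreparationPlus.lean`,
which is strictly steeper than the `δ`-line, so its initial unit term is shear invariant
(`IsInitialTerm.shear`). OUR COROLLARY of CJS Lemma 13.6 / Lemma 10.6 with `n = 1`.
[cite: CossartJannsenSaito2020, Lemma 13.6] [cite: Cutkosky2009, Lemma 10.6, p.30 l.59–63] -/
theorem exists_pts_shiftU₂_wPlus (phi : R) (hJμ : J ≤ maximalIdeal R ^ μ)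
    (hne : (pts c J μ).Nonempty) :
    ∃ e ∈ pts (shiftU₂ c phi) J μ,
      spt₁ μ e + spt₂ μ e = deltaS c J μ ∧ spt₂ μ e = gammaPlusS c J μ := by
  obtain ⟨e, he, h1, h2⟩ := exists_pts_wPlus hne
  have hL : μ.factorial ≤ spt₁ μ e + spt₂ μ e := factorial_le_spt_add c hgen hdim hJμ he
  have hLpos := Nat.factorial_pos μ
  have htp : 0 < tiltPN c J μ := Nat.succ_pos _
  have hlev := wPlusLevel_eq_of_wPlus (c := c) (J := J) (μ := μ) h1 h2
  have hmin : ∀ x ∈ pts c J μ, (tiltPN c J μ + 1) * spt₁ μ e + tiltPN c J μ * spt₂ μ e ≤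
      (tiltPN c J μ + 1) * spt₁ μ x + tiltPN c J μ * spt₂ μ x := by
    intro x hx; rw [hlev]; exact forall_pts_wPlusWeight x hx
  have hpos : 0 < (tiltPN c J μ + 1) * spt₁ μ e + tiltPN c J μ * spt₂ μ e := by
    have h3 : spt₁ μ e ≤ (tiltPN c J μ + 1) * spt₁ μ e := Nat.le_mul_of_pos_left _ (by omega)
    have h4 : spt₂ μ e ≤ tiltPN c J μ * spt₂ μ e := Nat.le_mul_of_pos_left _ htp
    omega
  obtain ⟨g, hgJ, hinit⟩ :=
    exists_isInitialTerm_levelWeight_of_isMinOn c hgen hdim (by omega) htp he hmin hpos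
  have hsteep : levelWeight μ ((tiltPN c J μ + 1) * spt₁ μ e + tiltPN c J μ * spt₂ μ e)
      (tiltPN c J μ + 1) (tiltPN c J μ) 2 <
      levelWeight μ ((tiltPN c J μ + 1) * spt₁ μ e + tiltPN c J μ * spt₂ μ e)
        (tiltPN c J μ + 1) (tiltPN c J μ) 1 := by
    rw [levelWeight_one, levelWeight_two]
    exact Nat.mul_lt_mul_of_pos_left (by omega) hLpos
  exact ⟨e, ⟨⟨g, hgJ, _, levelWeight_pos hpos (by omega) htp, hinit.shear c hsteep phi⟩, he.2⟩,
    h1, h2⟩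

include hgen hdim in
/-- **`γ⁺` is shear invariant**: the ordinate of the upper `δ`-vertex of `(y, u₁, u₂ + φu₁)` equals
that of `(y, u₁, u₂)` (`J ⊆ 𝔪^μ`, non-empty polygon): `w⁺` survives and the canonical line
`(N+1) x₁ + N x₂ ≥ (N+1) δs − γ⁺s` (`N = δs + 1`, `p₂ ≤ p₁`) transfers. OUR COROLLARY of CJS Lemma 13.6
/ Lemma 10.6 (`n = 1`; a fortiori for all `n`). [cite: CossartJannsenSaito2020, Lemma 13.6]
[cite: Cutkosky2009, Lemma 10.6, p.30 l.59–63] -/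
theorem gammaPlusS_shiftU₂ (phi : R) (hJμ : J ≤ maximalIdeal R ^ μ) (hne : (pts c J μ).Nonempty) :
    gammaPlusS (shiftU₂ c phi) J μ = gammaPlusS c J μ := by
  have hδ : deltaS (shiftU₂ c phi) J μ = deltaS c J μ := deltaS_shiftU₂ c hgen hdim phi hJμ hne
  have hne' := pts_shiftU₂_nonempty c hgen hdim phi hJμ hne
  obtain ⟨e, he', h1, h2⟩ := exists_pts_shiftU₂_wPlus c hgen hdim phi hJμ hne
  have hL := Nat.factorial_pos μ
  have hDpos : 0 < deltaS c J μ := by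
    have := factorial_le_deltaS c hgen hdim hJμ hne
    omega
  have hγδ : gammaPlusS c J μ ≤ deltaS c J μ := gammaPlusS_le_deltaS hne
  apply le_antisymm
  · obtain ⟨e', he'', h1', h2'⟩ := exists_pts_wPlus hne'
    have htp : 0 < tiltPN c J μ := Nat.succ_pos _
    have hw₀ : 0 < wPlusLevel c J μ := by
      rw [wPlusLevel]
      have : 2 * deltaS c J μ ≤ (tiltPN c J μ + 1) * deltaS c J μ :=
        Nat.mul_le_mul_right _ (by rw [tiltPN]; omega)
      omega
    have ht := forall_pts_shiftU₂_of_forall_pts c hgen hdim phi hw₀ htp (Nat.le_succ _)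
      forall_pts_wPlusWeight e' he''
    rw [wPlusLevel] at ht
    have hsplit : (tiltPN c J μ + 1) * spt₁ μ e' + tiltPN c J μ * spt₂ μ e' =
        tiltPN c J μ * (spt₁ μ e' + spt₂ μ e') + spt₁ μ e' := by ring
    have hsplit' : (tiltPN c J μ + 1) * deltaS c J μ = tiltPN c J μ * deltaS c J μ + deltaS c J μ := by
      ring
    rw [hsplit, hsplit', h1', hδ] at ht
    rw [← h2']
    rw [hδ] at h1'
    omega
  · rw [← h2]; exact le_gammaPlusS he' (by rw [hδ]; exact h1)

include hgen hdim in
/-- **Preparedness at `w⁺` is shear invariant** (`J ⊆ 𝔪^μ`, non-empty polygon): both systems have the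
same `δs`, `γ⁺s`, hence the same canonical line `(N+1) x₁ + N x₂` through `w⁺`, which is strictly
steeper than the `δ`-line, so solvability along it is shear invariant (`isSolvableAt_shiftU₂_iff`).
OUR COROLLARY of CJS Lemma 13.6 (cf. Prop. 14.3 (b)). [cite: CossartJannsenSaito2020, Lemma 13.6 and Prop. 14.3 (b)] -/
theorem wPlusPrepared_shiftU₂_iff (phi : R) (hJμ : J ≤ maximalIdeal R ^ μ)
    (hne : (pts c J μ).Nonempty) :
    WPlusPrepared (shiftU₂ c phi) J μ ↔ WPlusPrepared c J μ := by
  have hδ : deltaS (shiftU₂ c phi) J μ = deltaS c J μ := deltaS_shiftU₂ c hgen hdim phi hJμ hne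
  have hγ : gammaPlusS (shiftU₂ c phi) J μ = gammaPlusS c J μ := gammaPlusS_shiftU₂ c hgen hdim phi hJμ hne
  have hL := Nat.factorial_pos μ
  have hDpos : 0 < deltaS c J μ := by
    have := factorial_le_deltaS c hgen hdim hJμ hne
    omega
  have hγδ : gammaPlusS c J μ ≤ deltaS c J μ := gammaPlusS_le_deltaS hne
  have htilt : tiltPN (shiftU₂ c phi) J μ = tiltPN c J μ := by rw [tiltPN, tiltPN, hδ]
  have hlev : wPlusLevel (shiftU₂ c phi) J μ = wPlusLevel c J μ := by
    rw [wPlusLevel, wPlusLevel, htilt, hδ, hγ]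
  have hwt : wPlusWeight (shiftU₂ c phi) J μ = wPlusWeight c J μ := by
    rw [wPlusWeight, wPlusWeight, hlev, htilt]
  have htp : 0 < tiltPN c J μ := Nat.succ_pos _
  have hw₀ : 0 < wPlusLevel c J μ := by
    rw [wPlusLevel]
    have : 2 * deltaS c J μ ≤ (tiltPN c J μ + 1) * deltaS c J μ :=
      Nat.mul_le_mul_right _ (by rw [tiltPN]; omega)
    omega
  have hpos : ∀ i, 0 < wPlusWeight c J μ i := levelWeight_pos hw₀ (by omega) htp
  have hsteep : wPlusWeight c J μ 2 < wPlusWeight c J μ 1 := by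
    rw [wPlusWeight, levelWeight_one, levelWeight_two]
    exact Nat.mul_lt_mul_of_pos_left (by omega) hL
  unfold WPlusPrepared
  rw [hδ, hγ, hwt, hlev]
  refine forall_congr' fun v₁ => forall_congr' fun v₂ => forall_congr' fun lam =>
    forall_congr' fun _ => forall_congr' fun _ => not_congr ?_
  exact isSolvableAt_shiftU₂_iff c hgen hdim hpos hsteep phi

end Polygon

end Literature.AlgebraicGeometry.Resolution

end
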